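import Literature.AlgebraicGeometry.Resolution.StrictlyStandardElements
import Mathlib.RingTheory.Ideal.Quotient.Operations
import Mathlib.Algebra.MvPolynomial.Rename
import Mathlib.Data.Fin.Tuple.Basic
import HarnessLib

/-!
# The algebra `B = R[x]/(s'_1 f_1, …, s'_c f_c, g_1, …, g_t)` of the proof of Stacks 07F4

Topic: `Literature/AlgebraicGeometry/Resolution`. Groundwork for Stacks, Lemma 07F4 (and
through it for `Stacks07F5_reduceToField`, `NeronPopescuSteps.lean`). The second half of the
printed proof of 07F4 is localisation-free once the elements of `S` have been chosen:

> Consider the ring `B = R[x_1, …, x_{n+m}]/(s'_1 f_1, …, s'_c f_c, g_1, …, g_t)` and the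
> factorization `A → B → Λ` with `B → Λ` given by `x_i ↦ λ_i`. We claim that
> `s = s_0 s_1 … s_t s'_1 … s'_c` is elementary standard in `B` over `R` which finishes the
> proof. Namely, `s_j g_j ∈ (f_1, …, f_c)` and hence `s g_j ∈ (s'_1 f_1, …, s'_c f_c)`. Finally,
> we have `a_0 det(∂ s'_j f_j/∂x_i)_{i,j = 1, …, c} + ∑_{j} (s'_1 … ŝ'_j … s'_c) a_j s'_j f_j
> = s_0 s'_1 … s'_c` which divides `s` as desired.

`exists_elementaryStandard_algebra` PROVES exactly this: given polynomials
`f : Fin c → R[x_1, …, x_N]` (`c ≤ N`), `g : Fin t → R[x_1, …, x_n]` (`n ≤ N`), elements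
`λ : Fin N → Λ`, and elements `s_0`, `s_k`, `s'_j ∈ R` with
`a_0 det(∂f_j/∂x_i)_{i,j ≤ c} + ∑ a_j f_j = s_0`, `s_k g_k ∈ (f_1, …, f_c)`,
`s'_j f_j(λ) = 0` and `g_k(λ) = 0`, the `R`-algebra `B` receives `x_i ↦ x_i` compatibly with
the `g_k` (so that any `A = R[x_1, …, x_n]/(g)` maps to it), maps to `Λ` by `x_i ↦ λ_i`, and
`s_0 ∏ s_k ∏ s'_j` is elementary standard in `B` over `R` (Definition 07C7,
`IsElementaryStandard`, with the presentation of `B` by the displayed relations and `c`).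
Also two bookkeeping lemmas used with it: `jacobianMinor_C_mul`, `jacobianMinor_map`
(minors of rescaled relations / after a change of coefficients) and `span_range_unit_mul_eq`.
No new notions, no named facts.

## Sources

* The Stacks Project, *Smoothing Ring Maps* (Tag 07BW), proof of Lemma 07F4; Definition 07C7.
  [StacksProject]
-/

noncomputable section

open MvPolynomial

namespace Literature.AlgebraicGeometry.Resolution

universe u

section Core

variable {R Λ : Type u} [CommRing R] [CommRing Λ] [Algebra R Λ]

/-- Scaling the columns of a Jacobian minor: `det(∂(s'_j f_j)/∂x_i) = (∏ s'_j) det(∂f_j/∂x_i)`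
(for constants `s'_j ∈ R`). [folklore] -/
theorem jacobianMinor_C_mul {N m c : ℕ} (f : Fin m → MvPolynomial (Fin N) R) (s' : Fin m → R)
    (hc : c ≤ m) (e : Fin c → Fin N) :
    jacobianMinor (fun j => C (s' j) * f j) hc e =
      C (∏ j : Fin c, s' (Fin.castLE hc j)) * jacobianMinor f hc e := by
  unfold jacobianMinor
  have hM : (Matrix.of fun i j : Fin c => pderiv (e i) (C (s' (Fin.castLE hc j)) * f (Fin.castLE hc j))) =
      (Matrix.of fun i j : Fin c => pderiv (e i) (f (Fin.castLE hc j))) *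
        Matrix.diagonal fun j => C (s' (Fin.castLE hc j)) := by
    refine Matrix.ext fun i j => ?_
    rw [Matrix.mul_diagonal, Matrix.of_apply, Matrix.of_apply, pderiv_C_mul, mul_comm]
  rw [hM, Matrix.det_mul, Matrix.det_diagonal, map_prod, mul_comm]

/-- Jacobian minors commute with a change of coefficient ring. [folklore] -/
theorem jacobianMinor_map {R' : Type*} [CommRing R'] (φ : R →+* R') {N m c : ℕ}
    (f : Fin m → MvPolynomial (Fin N) R) (hc : c ≤ m) (e : Fin c → Fin N) :
    jacobianMinor (fun j => MvPolynomial.map φ (f j)) hc e =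
      MvPolynomial.map φ (jacobianMinor f hc e) := by
  unfold jacobianMinor
  rw [RingHom.map_det, RingHom.mapMatrix_apply]
  congr 1
  refine Matrix.ext fun i j => ?_
  rw [Matrix.map_apply, Matrix.of_apply, Matrix.of_apply, pderiv_map]

/-- Multiplying the members of a family by units does not change the ideal they generate.
[folklore] -/
theorem span_range_unit_mul_eq {T : Type*} [CommRing T] {m : ℕ} (f : Fin m → T) (e : Fin m → T)
    (he : ∀ j, IsUnit (e j)) :
    Ideal.span (Set.range fun j => e j * f j) = Ideal.span (Set.range f) := by
  apply le_antisymm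
  · rw [Ideal.span_le]
    rintro _ ⟨j, rfl⟩
    exact Ideal.mul_mem_left _ _ (Ideal.subset_span ⟨j, rfl⟩)
  · rw [Ideal.span_le]
    rintro _ ⟨j, rfl⟩
    obtain ⟨u, hu⟩ := he j
    have hf : f j = (↑u⁻¹ : T) * (e j * f j) := by
      rw [← mul_assoc, ← hu, Units.inv_mul, one_mul]
    rw [SetLike.mem_coe, hf]
    exact Ideal.mul_mem_left _ _ (Ideal.subset_span ⟨j, rfl⟩)

/-- **The algebra `B` of the proof of Stacks 07F4.** See the module docstring. Given the
polynomial data `f`, `g`, the point `λ` and the elements `s_0, s_k, s'_j ∈ R` with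
(d) `a_0 det(∂f_j/∂x_i)_{i,j ≤ c} + ∑_j a_j f_j = s_0` in `R[x_1, …, x_N]`,
(e) `s_k g_k ∈ (f_1, …, f_c)`, (f) `s'_j f_j(λ) = 0` in `Λ`, (g) `g_k(λ_1, …, λ_n) = 0` in `Λ`,
there is an `R`-algebra `B` (namely `R[x_1, …, x_N]/(s'_j f_j, g_k)`) with elements `x_i`
and an `R`-algebra map `w : B → Λ`, `x_i ↦ λ_i`, such that `g_k(x_1, …, x_n) = 0` in `B` and
`s_0 ∏ s_k ∏ s'_j` is elementary standard in `B` over `R`.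
[cite: StacksProject, Tag 07F4 (proof)] -/
theorem exists_elementaryStandard_algebra {N n c t : ℕ} (hcN : c ≤ N) (hnN : n ≤ N)
    (f : Fin c → MvPolynomial (Fin N) R) (g : Fin t → MvPolynomial (Fin n) R) (lam : Fin N → Λ)
    (s₀ : R) (s : Fin t → R) (s' : Fin c → R)
    (hd : ∃ (a₀ : MvPolynomial (Fin N) R) (a : Fin c → MvPolynomial (Fin N) R),
      a₀ * jacobianMinor f le_rfl (Fin.castLE hcN) + ∑ j, a j * f j = C s₀)
    (he : ∀ k, C (s k) * rename (Fin.castLE hnN) (g k) ∈ Ideal.span (Set.range f))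
    (hf : ∀ j, algebraMap R Λ (s' j) * aeval lam (f j) = 0)
    (hg : ∀ k, aeval (lam ∘ Fin.castLE hnN) (g k) = 0) :
    ∃ (B : Type u) (_ : CommRing B) (_ : Algebra R B) (x : Fin N → B) (w : B →ₐ[R] Λ),
      (∀ i, w (x i) = lam i) ∧ (∀ k, aeval (x ∘ Fin.castLE hnN) (g k) = 0) ∧
        IsElementaryStandard R (algebraMap R B (s₀ * (∏ k, s k) * ∏ j, s' j)) := by
  classical
  -- the relations and the algebra `B`
  let rels : Fin (c + t) → MvPolynomial (Fin N) R :=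
    Fin.append (fun j => C (s' j) * f j) (fun k => rename (Fin.castLE hnN) (g k))
  let J : Ideal (MvPolynomial (Fin N) R) := Ideal.span (Set.range rels)
  have hrel_left : ∀ j : Fin c, rels (Fin.castAdd t j) = C (s' j) * f j := fun j =>
    Fin.append_left _ _ j
  have hrel_right : ∀ k : Fin t, rels (Fin.natAdd c k) = rename (Fin.castLE hnN) (g k) := fun k =>
    Fin.append_right _ _ k
  have hmem_left : ∀ j : Fin c, C (s' j) * f j ∈ J := fun j => by
    rw [← hrel_left]
    exact Ideal.subset_span ⟨_, rfl⟩
  have hmem_right : ∀ k : Fin t, rename (Fin.castLE hnN) (g k) ∈ J := fun k => by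
    rw [← hrel_right]
    exact Ideal.subset_span ⟨_, rfl⟩
  let B : Type u := MvPolynomial (Fin N) R ⧸ J
  let x : Fin N → B := fun i => Ideal.Quotient.mk J (X i)
  have hxalg : (aeval x : MvPolynomial (Fin N) R →ₐ[R] B) = Ideal.Quotient.mkₐ R J :=
    MvPolynomial.algHom_ext fun i => by rw [aeval_X]; rfl
  have hx : ∀ p : MvPolynomial (Fin N) R, aeval x p = Ideal.Quotient.mk J p := fun p => by
    rw [hxalg]
    rfl
  -- the map `w : B → Λ`
  have hJ : ∀ p ∈ J, aeval lam p = 0 := by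
    have hle : J ≤ RingHom.ker (aeval lam : MvPolynomial (Fin N) R →ₐ[R] Λ) := by
      refine Ideal.span_le.mpr ?_
      rintro _ ⟨i, rfl⟩
      rw [SetLike.mem_coe, RingHom.mem_ker]
      refine Fin.addCases (fun j => ?_) (fun k => ?_) i
      · rw [hrel_left, map_mul, algHom_C]
        exact hf j
      · rw [hrel_right, aeval_rename]
        exact hg k
    intro p hp
    exact hle hp
  let w : B →ₐ[R] Λ := Ideal.Quotient.liftₐ J (aeval lam) hJ
  have hw : ∀ i, w (x i) = lam i := fun i => by
    change Ideal.Quotient.lift J ((aeval lam : MvPolynomial (Fin N) R →ₐ[R] Λ) : _ →+* Λ) hJ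
      (Ideal.Quotient.mk J (X i)) = lam i
    rw [Ideal.Quotient.lift_mk]
    exact aeval_X lam i
  have hgx : ∀ k, aeval (x ∘ Fin.castLE hnN) (g k) = 0 := fun k => by
    rw [← aeval_rename, hx]
    exact Ideal.Quotient.eq_zero_iff_mem.mpr (hmem_right k)
  refine ⟨B, inferInstance, inferInstance, x, w, hw, hgx, ?_⟩
  -- the presentation of `B` by `rels`
  let Pn : Algebra.Presentation R B (Fin N) (Fin (c + t)) := Algebra.Presentation.naive (v := rels)
  have hPval : ∀ p, aeval Pn.val p = Ideal.Quotient.mk J p := hx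
  have hPrel : Pn.relation = rels := rfl
  have hct : c ≤ c + t := Nat.le_add_right c t
  have hcast : ∀ j : Fin c, Fin.castLE hct j = Fin.castAdd t j := fun j => Fin.ext rfl
  -- products of the chosen elements
  set P' : R := ∏ j, s' j with hP'
  set Ps : R := ∏ k, s k with hPs
  -- the Jacobian minor of the first `c` relations
  have hminor : jacobianMinor Pn.relation hct (Fin.castLE hcN) =
      C P' * jacobianMinor f le_rfl (Fin.castLE hcN) := by
    have h1 : jacobianMinor Pn.relation hct (Fin.castLE hcN) =
        jacobianMinor (fun j => C (s' j) * f j) le_rfl (Fin.castLE hcN) := by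
      unfold jacobianMinor
      congr 1
      refine Matrix.ext fun i j => ?_
      rw [Matrix.of_apply, Matrix.of_apply, hPrel, hcast, hrel_left]
      rfl
    rw [h1, jacobianMinor_C_mul]
    rfl
  obtain ⟨a₀, a, hda⟩ := hd
  refine ⟨N, c + t, Pn, c, hcN, hct, ?_, ?_⟩
  · -- (16.2.3.1): `s = (∏ s_k) a₀ · det(∂(s'_j f_j)/∂x_i)` in `B`
    refine ⟨Ideal.Quotient.mk J (C Ps * a₀), ?_⟩
    rw [hPval, hminor, ← map_mul, IsScalarTower.algebraMap_apply R (MvPolynomial (Fin N) R) B,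
      MvPolynomial.algebraMap_eq, Ideal.Quotient.algebraMap_eq, Ideal.Quotient.eq]
    -- `C s - C Ps a₀ C P' D = C Ps (C P' (a₀ D + Σ a_j f_j) - a₀ C P' D) = Σ …` lies in `J`
    have hsum : C Ps * a₀ * (C P' * jacobianMinor f le_rfl (Fin.castLE hcN)) =
        C (s₀ * Ps * P') - ∑ j, C Ps * a j * (C P' * f j) := by
      refine eq_sub_of_add_eq ?_
      calc C Ps * a₀ * (C P' * jacobianMinor f le_rfl (Fin.castLE hcN)) +
            ∑ j, C Ps * a j * (C P' * f j)
          = C Ps * C P' * (a₀ * jacobianMinor f le_rfl (Fin.castLE hcN) + ∑ j, a j * f j) := by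
            rw [mul_add, Finset.mul_sum]
            congr 1
            · ring
            · exact Finset.sum_congr rfl fun j _ => by ring
        _ = C Ps * C P' * C s₀ := by rw [hda]
        _ = C (s₀ * Ps * P') := by rw [← map_mul, ← map_mul]; congr 1; ring
    rw [hsum, sub_sub_cancel]
    refine Ideal.sum_mem _ fun j _ => ?_
    have hPj : P' = (∏ j' ∈ Finset.univ.erase j, s' j') * s' j :=
      (Finset.prod_erase_mul Finset.univ s' (Finset.mem_univ j)).symm
    rw [hPj, map_mul, mul_assoc (C _) (C (s' j)) (f j), ← mul_assoc (C Ps * a j)]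
    exact Ideal.mul_mem_left _ _ (hmem_left j)
  · -- (16.2.3.2): `s g_k ∈ (s'_1 f_1, …, s'_c f_c)`
    refine liftCond_of_exists (C (s₀ * Ps * P')) (algHom_C _ _) fun j' hj' => ?_
    -- `j' = natAdd c k`
    obtain ⟨k, rfl⟩ : ∃ k : Fin t, Fin.natAdd c k = j' :=
      ⟨⟨j' - c, by omega⟩, Fin.ext (Nat.add_sub_cancel' hj')⟩
    refine Ideal.mem_sup_left ?_
    rw [hPrel, hrel_right]
    obtain ⟨q, hq⟩ := Ideal.mem_span_range_iff_exists_fun.mp (he k)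
    have hPsk : Ps = (∏ k' ∈ Finset.univ.erase k, s k') * s k :=
      (Finset.prod_erase_mul Finset.univ s (Finset.mem_univ k)).symm
    have hcalc : C (s₀ * Ps * P') * rename (Fin.castLE hnN) (g k) =
        ∑ j, (C (s₀ * ∏ k' ∈ Finset.univ.erase k, s k') * q j *
          C (∏ j'' ∈ Finset.univ.erase j, s' j'')) * (C (s' j) * f j) := by
      have h1 : C (s₀ * Ps * P') * rename (Fin.castLE hnN) (g k) =
          C (s₀ * ∏ k' ∈ Finset.univ.erase k, s k') * C P' * (C (s k) * rename (Fin.castLE hnN) (g k)) := by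
        rw [hPsk, map_mul, map_mul, map_mul, map_mul]
        ring
      rw [h1, ← hq, Finset.mul_sum]
      refine Finset.sum_congr rfl fun j _ => ?_
      have hPj : P' = (∏ j'' ∈ Finset.univ.erase j, s' j'') * s' j :=
        (Finset.prod_erase_mul Finset.univ s' (Finset.mem_univ j)).symm
      rw [hPj]
      simp only [map_mul]
      ring
    rw [hcalc]
    refine Ideal.sum_mem _ fun j _ => Ideal.mul_mem_left _ _ (Ideal.subset_span ⟨j, ?_⟩)
    change Pn.relation (Fin.castLE hct j) = _
    rw [hPrel, hcast, hrel_left]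

end Core

end Literature.AlgebraicGeometry.Resolution

end
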